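import Summits.BirchSwinnertonDyer.BirchSwinnertonDyer.Theorems.AlignedTransportAtTwoMainConjectureOfRankZeroBSDAtTwoFineRoadOddSplit
import Summits.BirchSwinnertonDyer.BirchSwinnertonDyer.Theorems.AlignedTransportAtTwoMainConjectureOfRankZeroBSDAtTwoFineRoadInfResRel
import HarnessLib

/-!
# Road (b″) netted, local brick (iii) continued: at ODD places the local conditions over `K_∞^{cyc}` are detected
# by restriction to `K(μ_{2^∞})` — the descent defect of `res`, `res₀` lives above `2`

Cell `bsd-f1-sign2`, WIDTH-5 attach seat `bsd-line-att-p4` (gen 4) on line `birth` of crux C2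
stmt-BirchSwinnertonDyer-22298 `MainConjectureOfRankZeroBSDAtTwo`; a `--supports 22298 --as helper` file, sequel of
`…FineRoadOddSplit` (`ker κ ⊓ D_v = ker χ₂ ⊓ D_v` for `v ∤ 2`: odd places split in `K(μ_{2^∞})/K_∞^{cyc}`) and of
`…FineRoadInfResRel` (`res`, `res₀` DEFINED). HONEST FRAMING: THEOREMS ONLY — no definition, no named fact, no
`sorry`; BSD is NOT proved by any of this.

* §1 `resOfLe_injective_of_eq` — restriction along an EQUALITY of subgroups is injective (it is the identity);
  `mem_awayKer_iff_of_inf_decomp_eq`, `mem_localKerOver_iff_of_inf_decomp_eq` — if `H ≤ H'` have the same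
  decomposition group at `v`, «locally trivial at `v`» resp. the classical Kummer condition at `K_v` of a class of
  `H¹(H', ·)` is equivalent to that of its restriction to `H` (transitivity of restriction;
  `WeierstrassCurve.localResOverOfEmb_resOfLe`); at `p = 2`, cyclotomic `κ`, odd `v`:
  **`resOfLe_mem_awayKer_iff_two`**, **`resOfLe_mem_localKerOver_iff_two`**.
* §2 THE DESCENT DEFECT LIVES ABOVE 2: **`mem_relaxedSelmer_iff_resOfLe_mem_and_above_two`** —
  `c ∈ Sel^{rel ∞}(E/K_∞^{cyc}) ⟺ res c ∈ Sel(E/K(μ_{2^∞})) ∧ (Kummer conditions of c at the places above 2)`;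
  **`mem_fineSelmerInftyRelaxedInf_iff_resOfLe_mem_and_above_two`** — the same for `Sel₀^{rel ∞}` and Greenberg's
  strict (fine) Selmer group upstairs. With att-p4 g3 (`…InfResSharp`/`…InfResSurj`: both global inf–res terms
  vanish on the seed cell) the cokernels of `res : Sel^{rel ∞}(ℚ_∞) → Sel(ℚ(ζ_{2^∞}))^Δ` and of `res₀` are
  supported at the prime above `2` ONLY (brick (ii): Coates–Greenberg 1996 / Imai, next).

References: R. Greenberg, LNM 1716 (1999), §3 (restriction maps `s_n`, `h_n`, `g_n`) and §4 p. 106; L. Washington,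
*Cyclotomic Fields* §13.1; J. Coates, R. Sujatha, Math. Ann. 331 (2005) §3; K. Kato, Astérisque 295 §17.13.
-/

set_option autoImplicit false
-- the Theorems namespace of this sub repeats the summit name by design (D-0017 nested layout)
set_option linter.dupNamespace false

noncomputable section

open scoped Classical

namespace Summit.BirchSwinnertonDyer.BirchSwinnertonDyer.Theorems.AlignedTransportAtTwoFineRoad.OddSplitDescent

open WeierstrassCurve NumberField IsDedekindDomain Field Literature.NumberTheory.EllipticCurves
  Literature.NumberTheory.EllipticCurves.GreenbergSelmer Literature.NumberTheory.GaloisRepresentations ZpExtension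
  OddSplit

universe u

/-! ## §1 The local conditions at odd places are detected upstairs -/

section Generic

variable {G : Type u} [Group G] [TopologicalSpace G] [IsTopologicalGroup G]
  (M : Type u) [AddCommGroup M] [DistribMulAction G M] [TopologicalSpace M] [DiscreteTopology M]

/-- Restriction `res : H¹(H', M) → H¹(H, M)` along an EQUALITY `H = H'` of subgroups is injective (it is the
identity, `resOfLe_refl_holds`). [cite: NeukirchSchmidtWingberg2008, I.§5] -/
theorem resOfLe_injective_of_eq {H H' : Subgroup G} (e : H = H') (h : H ≤ H') :
    Function.Injective (resOfLe M h) := by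
  subst e
  have hid : resOfLe M h = AddMonoidHom.id _ := resOfLe_refl_holds (M := M) H
  rw [hid]
  exact fun _ _ hab ↦ hab

end Generic

section LocalIff

variable {K : Type} [Field K] [NumberField K] (M : Type) [AddCommGroup M]
  [DistribMulAction (absoluteGaloisGroup K) M] [TopologicalSpace M] [DiscreteTopology M]

/-- If `H ≤ H'` have the SAME decomposition group at `v` (`H ⊓ D_v = H' ⊓ D_v`), then a class of `H¹(H', M)` is
locally trivial at the chosen place above `v` iff its restriction to `H` is (transitivity of restriction, and
restriction along `H ⊓ D_v = H' ⊓ D_v` is injective). [cite: GreenbergLNM1716, §3] -/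
theorem mem_awayKer_iff_of_inf_decomp_eq {H H' : Subgroup (absoluteGaloisGroup K)} (h : H ≤ H')
    {v : HeightOneSpectrum (𝓞 K)} (e : H ⊓ decomp v = H' ⊓ decomp v) (c : subgroupH1 H' M) :
    resOfLe M h c ∈ awayKer H M v ↔ c ∈ awayKer H' M v := by
  rw [awayKer, AddMonoidHom.mem_ker, awayKer, AddMonoidHom.mem_ker]
  have e1 := congrArg (fun f ↦ f c) (resOfLe_comp_holds (M := M) (inf_le_left : H ⊓ decomp v ≤ H) h)
  have e2 := congrArg (fun f ↦ f c) (resOfLe_comp_holds (M := M)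
    (inf_le_inf_right (decomp v) h : H ⊓ decomp v ≤ H' ⊓ decomp v) (inf_le_left : H' ⊓ decomp v ≤ H'))
  simp only [AddMonoidHom.coe_comp, Function.comp_apply] at e1 e2
  rw [e1, ← e2]
  exact (resOfLe_injective_of_eq M e (inf_le_inf_right (decomp v) h)).eq_iff' (map_zero _)

variable (W : WeierstrassCurve K) {p : ℕ}

/-- The same for the CLASSICAL Kummer condition of `E[p^∞]` at the completion `K_v`: if `H ⊓ D_v = H' ⊓ D_v`
(`H ≤ H'`), then `c ∈ H¹(H', E[p^∞])` satisfies the Kummer condition at the chosen place above `v` iff `res c` does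
— the local subgroups `res_v⁻¹(H) = res_v⁻¹(H') ≤ Γ_{K_v}` coincide, the local restrictions commute with `res`
(`WeierstrassCurve.localResOverOfEmb_resOfLe`), and restriction along an equality is injective.
[cite: GreenbergLNM1716, §3] -/
theorem mem_localKerOver_iff_of_inf_decomp_eq {H H' : Subgroup (absoluteGaloisGroup K)} (h : H ≤ H')
    {v : HeightOneSpectrum (𝓞 K)} (e : H ⊓ decomp v = H' ⊓ decomp v) (c : W.subgroupH1 p H') :
    W.resOfLe p h c ∈ W.localKerOver p H (v.adicCompletion K) ↔
      c ∈ W.localKerOver p H' (v.adicCompletion K) := by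
  rw [WeierstrassCurve.localKerOver_eq_ofEmb, WeierstrassCurve.localKerOver_eq_ofEmb,
    WeierstrassCurve.localKerOverOfEmb, WeierstrassCurve.localKerOverOfEmb, AddMonoidHom.mem_ker,
    AddMonoidHom.mem_ker, WeierstrassCurve.localResOverOfEmb_resOfLe]
  have eloc : localSubgroupOfEmb H (closureEmb (K := K) (v.adicCompletion K)) =
      localSubgroupOfEmb H' (closureEmb (K := K) (v.adicCompletion K)) := by
    ext τ
    rw [mem_localSubgroupOfEmb_iff, mem_localSubgroupOfEmb_iff]
    have hτ : resGalOfEmb (closureEmb (K := K) (v.adicCompletion K)) τ ∈ decomp v := ⟨τ, rfl⟩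
    exact ⟨fun hH ↦ (e.le ⟨hH, hτ⟩).1, fun hH' ↦ (e.ge ⟨hH', hτ⟩).1⟩
  exact (resOfLe_injective_of_eq (localPoints W (v.adicCompletion K)) eloc _).eq_iff' (map_zero _)

variable (κ : ZpExtension K 2)

/-- **At an odd place, «locally trivial» is detected upstairs** (any discrete `Γ_K`-module `M`, cyclotomic `κ`,
`v ∤ 2`): for `c ∈ H¹(K_∞^{cyc}, M)`, `res c ∈ H¹(K(μ_{2^∞}), M)` is locally trivial at the chosen place above `v`
iff `c` is. Hence the local term at `v` of `coker(res₀ : Sel₀^{rel ∞}(K_∞) → Sel₀(K(μ_{2^∞}))^Δ)` vanishes.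
[cite: GreenbergLNM1716, §3] [cite: Washington1997, §13.1] -/
theorem resOfLe_mem_awayKer_iff_two (hκ : κ.IsCyclotomic) {v : HeightOneSpectrum (𝓞 K)}
    (hv : ((2 : ℕ) : 𝓞 K) ∉ v.asIdeal) (c : subgroupH1 κ.kerSubgroup M) :
    resOfLe M (InfRes.ker_cyclotomicCharacter_le_kerSubgroup κ hκ) c ∈
        awayKer (GaloisRep.cyclotomicCharacter K 2).toMonoidHom.ker M v ↔
      c ∈ awayKer κ.kerSubgroup M v :=
  mem_awayKer_iff_of_inf_decomp_eq M _ (kerSubgroup_inf_decomp_eq κ hκ hv).symm c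

/-- **At an odd place, the classical Kummer condition is detected upstairs** (cyclotomic `κ`, `v ∤ 2`, any
Weierstrass curve `W/K`): for `c ∈ H¹(K_∞^{cyc}, E[2^∞])`, `res c` satisfies the Kummer condition at the chosen
place of `K(μ_{2^∞})` above `v` iff `c` does at the place of `K_∞^{cyc}` below it. Hence the local term at `v` of
`coker(res : Sel^{rel ∞}(K_∞) → Sel(K(μ_{2^∞}))^Δ)` vanishes. [cite: GreenbergLNM1716, §3] [cite: Washington1997, §13.1] -/
theorem resOfLe_mem_localKerOver_iff_two (hκ : κ.IsCyclotomic) {v : HeightOneSpectrum (𝓞 K)}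
    (hv : ((2 : ℕ) : 𝓞 K) ∉ v.asIdeal) (c : W.subgroupH1 2 κ.kerSubgroup) :
    W.resOfLe 2 (InfRes.ker_cyclotomicCharacter_le_kerSubgroup κ hκ) c ∈
        W.localKerOver 2 (GaloisRep.cyclotomicCharacter K 2).toMonoidHom.ker (v.adicCompletion K) ↔
      c ∈ W.localKerOver 2 κ.kerSubgroup (v.adicCompletion K) :=
  mem_localKerOver_iff_of_inf_decomp_eq W _ (kerSubgroup_inf_decomp_eq κ hκ hv).symm c

end LocalIff

/-! ## §2 The descent defect of road (b″) lives above `2` -/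

section AboveTwo

variable {K : Type} [Field K] [NumberField K] (κ : ZpExtension K 2) (W : WeierstrassCurve K)

/-- If `res c ∈ Sel_{2^∞}(E/K(μ_{2^∞}))`, then `c ∈ H¹(K_∞^{cyc}, E[2^∞])` satisfies the classical Kummer condition at
EVERY place of `K_∞^{cyc}` above an odd `v` (all conjugates `conj_σ c`; `conj_σ` commutes with `res`,
`resOfLe_comp_conjH1_holds`, and §1). [cite: GreenbergLNM1716, §3] -/
theorem conjH1_mem_localKerOver_of_resOfLe_mem_selmerGroupOver (hκ : κ.IsCyclotomic)
    {c : W.subgroupH1 2 κ.kerSubgroup}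
    (hres : W.resOfLe 2 (InfRes.ker_cyclotomicCharacter_le_kerSubgroup κ hκ) c ∈
      W.selmerGroupOver 2 (GaloisRep.cyclotomicCharacter K 2).toMonoidHom.ker)
    {v : HeightOneSpectrum (𝓞 K)} (hv : ((2 : ℕ) : 𝓞 K) ∉ v.asIdeal) (σ : absoluteGaloisGroup K) :
    W.conjH1 2 κ.kerSubgroup σ c ∈ W.localKerOver 2 κ.kerSubgroup (v.adicCompletion K) := by
  set h := InfRes.ker_cyclotomicCharacter_le_kerSubgroup κ hκ with hh
  rw [WeierstrassCurve.mem_selmerGroupOver_iff] at hres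
  have h1 := hres.1 v σ
  have hcomm : W.conjH1 2 _ σ (W.resOfLe 2 h c) = W.resOfLe 2 h (W.conjH1 2 κ.kerSubgroup σ c) :=
    (congrArg (fun f ↦ f c) (resOfLe_comp_conjH1_holds (M := geomPrimaryTorsion W 2) h σ)).symm
  rw [hcomm] at h1
  exact (resOfLe_mem_localKerOver_iff_two W κ hκ hv _).1 h1

/-- **THE DESCENT DEFECT LIVES ABOVE 2 (Selmer side).** For the cyclotomic `ℤ₂`-extension of a number field `K`
and any `W/K`: a class `c ∈ H¹(K_∞^{cyc}, E[2^∞])` lies in the relaxed-at-`∞` Selmer group `Sel^{rel ∞}(E/K_∞^{cyc})`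
(Kummer conditions at all FINITE places, the source of `res` in ARCH-NETTING (ii)) IFF its restriction lies in
`Sel_{2^∞}(E/K(μ_{2^∞}))` AND `c` satisfies the Kummer conditions at the places above `2`. (`⟹`:
`InfResRel.resOfLe_relaxedSelmer_mem_selmerGroupOver_kerCyc`; `⟸`: odd places by §1, places above `2` by
hypothesis.) So `coker(res : Sel^{rel ∞}(K_∞) → Sel(K(μ_{2^∞}))^Δ)` has NO contribution from the odd places.
[cite: GreenbergLNM1716, §3 and §4 (PDF p. 106)] [cite: Kato2004Asterisque, §17.13] -/
theorem mem_relaxedSelmer_iff_resOfLe_mem_and_above_two (hκ : κ.IsCyclotomic)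
    (c : W.subgroupH1 2 κ.kerSubgroup) :
    c ∈ (⨅ (v : HeightOneSpectrum (𝓞 K)) (σ : absoluteGaloisGroup K),
        (W.localKerOver 2 κ.kerSubgroup (v.adicCompletion K)).comap (W.conjH1 2 κ.kerSubgroup σ)) ↔
      W.resOfLe 2 (InfRes.ker_cyclotomicCharacter_le_kerSubgroup κ hκ) c ∈
          W.selmerGroupOver 2 (GaloisRep.cyclotomicCharacter K 2).toMonoidHom.ker ∧
        ∀ (v : HeightOneSpectrum (𝓞 K)), ((2 : ℕ) : 𝓞 K) ∈ v.asIdeal → ∀ σ : absoluteGaloisGroup K,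
          W.conjH1 2 κ.kerSubgroup σ c ∈ W.localKerOver 2 κ.kerSubgroup (v.adicCompletion K) := by
  constructor
  · intro hc
    refine ⟨(InfResRel.resOfLe_relaxedSelmer_mem_selmerGroupOver_kerCyc κ W hκ hc).1, fun v _ σ ↦ ?_⟩
    simp only [AddSubgroup.mem_iInf, AddSubgroup.mem_comap] at hc
    exact hc v σ
  · rintro ⟨hres, h2⟩
    simp only [AddSubgroup.mem_iInf, AddSubgroup.mem_comap]
    intro v σ
    by_cases hv : ((2 : ℕ) : 𝓞 K) ∈ v.asIdeal
    · exact h2 v hv σ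
    · exact conjH1_mem_localKerOver_of_resOfLe_mem_selmerGroupOver κ W hκ hres hv σ

/-- **THE DESCENT DEFECT LIVES ABOVE 2 (fine side).** For the cyclotomic `ℤ₂`-extension and any `W/K`:
`c ∈ Sel₀^{rel ∞}(K_∞^{cyc}, E[2^∞])` (`W.fineSelmerInftyRelaxedInf κ`: locally trivial at all finite places) IFF
`res c` lies in Greenberg's strict Selmer group for the fine data over `K(μ_{2^∞})` (= `Sel₀(K(μ_{2^∞}), E[2^∞])`,
no archimedean condition upstairs, `InfResRel` §2) AND `c` is locally trivial at the places above `2`. (`⟹`: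
`InfResRel.resOfLe_fineRelaxed_mem_strictSelmerGroupOver_kerCyc`; `⟸`: odd places by §1.) So
`coker(res₀ : Sel₀^{rel ∞}(K_∞) → Sel₀(K(μ_{2^∞}))^Δ)` has NO contribution from the odd places.
[cite: GreenbergLNM1716, §3 and §4 (PDF p. 106)] [cite: CoatesSujatha2005, §3] -/
theorem mem_fineSelmerInftyRelaxedInf_iff_resOfLe_mem_and_above_two (hκ : κ.IsCyclotomic)
    (c : W.subgroupH1 2 κ.kerSubgroup) :
    c ∈ W.fineSelmerInftyRelaxedInf κ ↔
      W.resOfLe 2 (InfRes.ker_cyclotomicCharacter_le_kerSubgroup κ hκ) c ∈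
          strictSelmerGroupOver (GaloisRep.cyclotomicCharacter K 2).toMonoidHom.ker (W.geomPrimaryTorsion 2) 2
            (fineData (W.geomPrimaryTorsion 2) 2) ∧
        ∀ (v : HeightOneSpectrum (𝓞 K)), ((2 : ℕ) : 𝓞 K) ∈ v.asIdeal → ∀ σ : absoluteGaloisGroup K,
          W.conjH1 2 κ.kerSubgroup σ c ∈ awayKer κ.kerSubgroup (W.geomPrimaryTorsion 2) v := by
  set h := InfRes.ker_cyclotomicCharacter_le_kerSubgroup κ hκ with hh
  have hcomm : ∀ σ : absoluteGaloisGroup K,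
      W.conjH1 2 _ σ (W.resOfLe 2 h c) = W.resOfLe 2 h (W.conjH1 2 κ.kerSubgroup σ c) := fun σ ↦
    (congrArg (fun f ↦ f c) (resOfLe_comp_conjH1_holds (M := geomPrimaryTorsion W 2) h σ)).symm
  constructor
  · intro hc
    refine ⟨(InfResRel.resOfLe_fineRelaxed_mem_strictSelmerGroupOver_kerCyc κ W hκ hc).1, fun v hv σ ↦ ?_⟩
    have hc' := (mem_strictSelmerGroupOverRelaxedInf_iff (H := κ.kerSubgroup) (M := W.geomPrimaryTorsion 2)
      (L := fineData (W.geomPrimaryTorsion 2) 2) c).1 hc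
    have h2 := hc'.2 v hv σ
    change _ ∈ (fineLocalDatum (W.geomPrimaryTorsion 2) v).strictKer _ at h2
    rwa [LocalAway.strictKer_fineLocalDatum_eq_awayKer] at h2
  · rintro ⟨hres, habove⟩
    have hres' := (mem_strictSelmerGroupOver_iff (H := (GaloisRep.cyclotomicCharacter K 2).toMonoidHom.ker)
      (M := W.geomPrimaryTorsion 2) (L := fineData (W.geomPrimaryTorsion 2) 2) _).1 hres
    refine (mem_strictSelmerGroupOverRelaxedInf_iff (H := κ.kerSubgroup) (M := W.geomPrimaryTorsion 2)
      (L := fineData (W.geomPrimaryTorsion 2) 2) c).2 ⟨fun v hv σ ↦ ?_, fun v hv σ ↦ ?_⟩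
    · have h1 := hres'.1 v hv σ
      rw [hcomm] at h1
      exact (resOfLe_mem_awayKer_iff_two (W.geomPrimaryTorsion 2) κ hκ hv _).1 h1
    · change _ ∈ (fineLocalDatum (W.geomPrimaryTorsion 2) v).strictKer _
      rw [LocalAway.strictKer_fineLocalDatum_eq_awayKer]
      exact habove v hv σ

end AboveTwo

end Summit.BirchSwinnertonDyer.BirchSwinnertonDyer.Theorems.AlignedTransportAtTwoFineRoad.OddSplitDescent

end
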